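import Mathlib
import HarnessLib

/-!
# Reflection positivity of the Riesz kernel `|x - y|^{-λ}` through hyperplanes (Frank–Lieb)

Named fact (D-0014), statement only. For `0 < λ < N` (`N = 1, 2`) resp. `N - 2 ≤ λ < N`
(`N ≥ 3`) and a half-space `H = {x ∈ ℝ^N | ⟪x, e⟫ > t}`, the Riesz form
`I_λ[g, f] = ∬ conj(g x) f y |x - y|^{-λ} dx dy` satisfies `I_λ[Θ_H f, f] ≥ 0` for `f` supported
in `H`, where `(Θ_H f)(x) = f(Θ_H x)` and `Θ_H x = x + 2(t - ⟪x, e⟫) e` is the mirror image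
(R. L. Frank, E. H. Lieb, *Inversion positivity and the sharp Hardy–Littlewood–Sobolev
inequality*, Calc. Var. PDE 39 (2010), Theorem 1.2 (half-space case) with Lemma 2.1
(representation formula, whose right side is non-negative) and the invariance (1.7)
`I_λ[Θ_H f] = I_λ[f]`, which makes `I_λ[Θ_H f, f]` real). For `N ≥ 3` the lower bound
`λ ≥ N - 2` is necessary (ibid. Remark 1.3 / Remark 2.4: for `0 < λ < N - 2` the form takes both
signs) — recorded here in prose only.

Design choices. The printed theorem is for `f ∈ L^{2N/(2N-λ)}(ℝ^N)` with support in the CLOSED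
half-space; we state the special case of continuous `f` with compact support inside the OPEN
half-space, for which the double integral is a Bochner integral of a bounded compactly supported
integrand (the supports of `f` and `f ∘ Θ_H` are at positive distance, so no singularity of the
kernel is met and no junk value can occur). This is an instance of the printed statement
(`C_c ⊂ L^p`), hence weaker, and it is the form met by lattice/kernel reflection-positivity
arguments (finite sums of point masses follow from it by mollification, NOT by instantiation).
In `ℝ³` it says: the isotropic kernel `|x|^{-2Δ}` is reflection positive through every plane
iff... (if) `Δ ≥ 1/2` — the termwise input for the coordinate-mirror positivity of Gaussian
scale mixtures `Γ(Δ) ∫ (ω • x²)^{-Δ} Φ(dω)` quoted by route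
CriticalPhenomena/Ising3DConformalLimit `GaussianScaleMixture` (item `GSMRigidity`) and by
`HyperoctahedralRP` (item `HRP2Rigidity`). What is NOT here: the ball/inversion case of
Theorem 1.2, the strictness assertion for `λ > N - 2`, the HLS inequality itself (Theorem 1.1),
and any proof.
-/

namespace Literature.Analysis.Potential

open _root_.MeasureTheory

/-- The mirror map of the half-space `H = {x | t < ⟪x, e⟫}` (`e` a unit vector):
`Θ_H x = x + 2 (t - ⟪x, e⟫) e` (Frank–Lieb 2010, §1, the display defining `Θ_H`).
[cite: FrankLieb2010, §1 (definition of Θ_H)] -/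
noncomputable def halfSpaceReflection {N : ℕ} (e : EuclideanSpace ℝ (Fin N)) (t : ℝ)
    (x : EuclideanSpace ℝ (Fin N)) : EuclideanSpace ℝ (Fin N) :=
  x + (2 * (t - @inner ℝ _ _ x e)) • e

/-- The Riesz (Hardy–Littlewood–Sobolev) form
`I_λ[g, f] = ∬_{ℝ^N × ℝ^N} conj(g x) · f y · |x - y|^{-λ} dx dy` (Frank–Lieb 2010, (1.2)),
written as an iterated Bochner integral (value `0` by convention where not integrable; the
named fact below only uses it on bounded compactly supported integrands).
[cite: FrankLieb2010, §1 eq. (1.2)] -/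
noncomputable def rieszForm {N : ℕ} (lam : ℝ) (g f : EuclideanSpace ℝ (Fin N) → ℂ) : ℂ :=
  ∫ x, ∫ y, (starRingEnd ℂ) (g x) * f y * (((‖x - y‖ ^ (-lam) : ℝ)) : ℂ)

/-- **Reflection positivity of `|x - y|^{-λ}` through hyperplanes (Frank–Lieb 2010, Theorem 1.2,
half-space case, with Lemma 2.1).** *Let `0 < λ < N` if `N = 1, 2` and `N - 2 ≤ λ < N` if
`N ≥ 3`, and let `H = {x | x · e > t}` be a half-space, `Θ_H(x) = x + 2(t - x · e)`,
`(Θ_H f)(x) = f(Θ_H x)`. Then `½ (I_λ[fⁱ] + I_λ[fᵒ]) ≥ I_λ[f]`* — for `f` supported in `H` this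
reads (using `I_λ[Θ_H f] = I_λ[f]`, (1.7), and Lemma 2.1, whose right side is non-negative)
`I_λ[Θ_H f, f] ≥ 0`, a real number. Stated for continuous compactly supported `f` with
`tsupport f ⊆ H` (an instance of the printed `f ∈ L^{2N/(2N-λ)}`, `supp f ⊆ H̄`). Named fact
(D-0014), not proved here. Grounds, as the termwise isotropic input, the coordinate-mirror
positivity used by `Summit.CriticalPhenomena.Ising3DConformalLimit.Theses.GaussianScaleMixture.GSMRigidity`
(d = 3, λ = 2Δ ≥ 1 ⇔ Δ ≥ 1/2) and by `…Theses.HyperoctahedralRP.HRP2Rigidity`.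
[cite: FrankLieb2010, Thm 1.2 and Lemma 2.1] -/
def FrankLieb2010_rieszKernel_reflectionPositive : Prop :=
  ∀ (N : ℕ) (lam : ℝ), 0 < lam → lam < N → (3 ≤ N → (N : ℝ) - 2 ≤ lam) →
    ∀ (e : EuclideanSpace ℝ (Fin N)) (t : ℝ), ‖e‖ = 1 →
      ∀ f : EuclideanSpace ℝ (Fin N) → ℂ, Continuous f → HasCompactSupport f →
        tsupport f ⊆ {x | t < @inner ℝ _ _ x e} →
          0 ≤ (rieszForm lam (f ∘ halfSpaceReflection e t) f).re ∧
            (rieszForm lam (f ∘ halfSpaceReflection e t) f).im = 0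

/-- Sanity check of the mirror map: it fixes the boundary hyperplane `{⟪x, e⟫ = t}` pointwise.
[folklore] -/
theorem halfSpaceReflection_of_inner_eq {N : ℕ} (e x : EuclideanSpace ℝ (Fin N)) (t : ℝ)
    (hx : @inner ℝ _ _ x e = t) : halfSpaceReflection e t x = x := by
  simp [halfSpaceReflection, hx]

/-- Sanity check of the mirror map: for a unit normal `e` it is an involution. [folklore] -/
theorem halfSpaceReflection_halfSpaceReflection {N : ℕ} (e x : EuclideanSpace ℝ (Fin N))
    (t : ℝ) (he : ‖e‖ = 1) :
    halfSpaceReflection e t (halfSpaceReflection e t x) = x := by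
  have hee : @inner ℝ _ _ e e = 1 := by
    rw [real_inner_self_eq_norm_sq, he]; norm_num
  simp only [halfSpaceReflection, inner_add_left, inner_smul_left, hee, RCLike.conj_to_real]
  rw [add_assoc, ← add_smul]
  have : 2 * (t - @inner ℝ _ _ x e) + 2 * (t - (@inner ℝ _ _ x e + 2 * (t - @inner ℝ _ _ x e) * 1)) = 0 := by
    ring
  rw [this, zero_smul, add_zero]

end Literature.Analysis.Potential
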